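import Summits.CriticalPhenomena.PercolationContinuityZ3.Theses.PercLupuEnvironment
import Literature.Probability.LatticeModels.CableGFFLevelSets

/-!
# `Lines/birth.lean` — birth skeleton for crux `PercLupuEnvironment.SubcriticalDisorderStability`
(item stmt-CriticalPhenomena-6988 · route route-CriticalPhenomena-PercLupuEnvironment ·
sub-problem `PercolationContinuityZ3` · skeleton-register by
planner-skel-stmt-CriticalPhenomena-6988-0, 2026-08-17)

**Crux (rank 3, G1 of the route).** `SubcriticalDisorderStability`: for every discrete Gaussian
free field `g` of `ℤ³` (centred Gaussian process, `E g_x g_y = latticeGreen(x−y)/2`) and every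
level `a > 0` with `1 − e^{−2a²} < p_c(ℤ³)` there is `σ₁ > 0` such that for all `0 < σ < σ₁` the
ANNEALED Lupu model with field `a + σ g` does not percolate:
`∫ P^{lupuWeight (a + σ g(ω))}(|C(0)| = ∞) dP(ω) = 0` — weak GFF disorder cannot make strictly
subcritical Bernoulli percolation percolate (`liminf_{σ→0} m_c(σ) ≥ a_c`).

**The line ("subcritical sea with high GFF islands").**  Fix a margin `δ > 0` with
`q := 1 − e^{−2(a+δ)²} < p_c` (openness).  On every edge `{x,y}` whose endpoints both have
`σ g ≤ δ` the Lupu weight `1 − exp(−2(a+σg_x)⁺(a+σg_y)⁺)` is `≤ q`; every other edge touches the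
ISLAND SET `{x : g_x ≥ δ/σ}` — the excursion set of the GFF above the level `h = δ/σ → ∞`.  Hence,
realisation by realisation, the quenched Lupu measure is stochastically dominated (on the
increasing event `{|C(0)| = ∞}`) by the SEA–ISLAND MODEL `𝐏_{S,q}`: independent bonds, open with
probability `1` if the bond touches `S` and `q` otherwise (`islandWeight S q`), with
`S = {g ≥ h}`.  The crux is thereby TRANSFERRED to

  `IslandStability(q)`: for `q < p_c` there is `h₀` with: for all `h ≥ h₀`, for `P`-a.e. `ω`,
  `𝐏_{{g(ω) ≥ h}, q}(|C(0)| = ∞) = 0`,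

a statement about a HOMOGENEOUS subcritical Bernoulli sea plus the forced-open star of a
strongly subcritical GFF excursion set (`h ≫ h_**`), to which the level-set technology applies
directly (Rodriguez–Sznitman 2013 renormalisation, Popov–Ráth 2015 decoupling, sharpness of
Bernoulli percolation for the seed).  `IslandStability` is cut along the classical
seed / renormalisation seam, so the skeleton has THREE stubs of three different natures:

* `stub_islandDomination` (coupling; M) — the quenched domination `P^{lupuWeight φ}(|C(0)|=∞) ≤
  𝐏_{S,q}(|C(0)|=∞)` whenever `t > 0`, `{t < φ} ⊆ S` and `1 − e^{−2t²} ≤ q`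
  (pointwise comparison of the weights + Grimmett's monotone coupling
  `prodBernoulli_real_mono_of_isUpperSet`).
* `stub_seedEstimate` (sharpness input; M) — for `q < p_c(ℤ³)`, every `κ > 0` and every `N₀` there
  are a scale `N ≥ N₀` and a level `h₁` such that for all `h ≥ h₁` the annealed box-weighted one-arm
  probability of the sea–island model satisfies `|Λ_N| · E 𝐏_{{g≥h},q}(0 ↔ ∂Λ_N in Λ_N) ≤ κ`
  (exponential decay at `q < p_c`, `perc_sharpness_holds`, makes `|Λ_N| θ_N(q) → 0`; locality of the
  one-arm event and a Chebyshev/Gaussian tail `P(g_x ≥ h) ≤ G(0,0)/h²` remove the islands from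
  `Λ_N` as `h → ∞`).
* `stub_finiteSizeCriterion` (sprinkled multiscale renormalisation; L–XL, the HARDEST stub) —
  there are UNIVERSAL `κ > 0`, `N₀` such that for every GFF, every `q`, `h`, and every `N ≥ N₀`:
  `|Λ_N| · E 𝐏_{{g≥h−1},q}(0 ↔ ∂Λ_N in Λ_N) ≤ κ` implies `𝐏_{{g(ω)≥h},q}(|C(0)|=∞) = 0` for a.e. `ω`.
  This is the Rodriguez–Sznitman cascade for the JOINT field `(η, g)` (Bernoulli sea `η`
  independent of `g`): annulus-crossing events at scales `L_n = l₀ⁿ N` are increasing in `(η, g)`;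
  the `η`-parts of far-apart boxes are exactly independent, the `g`-parts decouple by the
  sprinkled decoupling inequality (Popov–Ráth 2015 Thm 1.1, error `exp(−c δ² s^{d−2})`, `d = 3`)
  with sprinkling budget `Σ δ_n = 1` in the level — whence the hypothesis at level `h − 1` and the
  conclusion at level `h`; the seed `p₀ ≤ |Λ_N| π(N)` is the union bound + stationarity.
* `SubcriticalDisorderStability_of` — the composition, kernel-checked and `sorry`-free (~90 lines:
  margin `δ` by continuity of `s ↦ 1 − e^{−2s²}`, `q` as a point of `[0,1]`, `h₀ := max (h₁+1) 1`,
  `σ₁ := δ/h₀`, level `lev = δ/σ > h₀`, domination a.e., `integral_eq_zero_of_ae`).  It concludes the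
  crux BY NAME (`crux_iff_lupuForm` is `Iff.rfl`: the route's inline `let W := …` IS
  `Literature.Probability.LatticeModels.lupuWeight`, and its three GFF hypotheses ARE
  `IsDiscreteGFF`).

No stub alone gives the crux (domination speaks of no GFF; the seed is a finite-volume bound; the
criterion is an implication with a universal threshold nobody has verified), none is the conjunct
`θ(p_c) = 0` in disguise (all three hold verbatim in a world with `θ(p_c) > 0`: they live at
`q < p_c` or are `q`-free).  BC3 probes (`stub → SubcriticalDisorderStability`,
`stub → PercolationContinuityZ3` by `first | exact? | simpa [S] | (unfold S; simpa) | aesop`) fail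
6/6 combined and 24/24 with every alternative run separately (400000 heartbeats each) — table in
`Lines/birth.md`.  Stationarity / law-uniqueness inputs for stubs 2–3 are in the tree
(`DiscreteGFFLawUniqueness`: `eq_of_isDiscreteGFF`, `map_shift_eq`); sharpness is
`DCT16.perc_sharpness_holds`; the GFF decoupling inequality (RS13 Thm 2.1 / PR15 Thm 1.1) is NOT yet
a Literature fact — the first thing a stub-3 prover files.

Disproof / negatives honoured: `Cruxes/SubcriticalDisorderStability/` had no workfiles before this
one (no `Disproof.lean`, no `_false_without_` theorem, no landed `Negative/*`);
`ledger negatives --problem CriticalPhenomena` has no statement about disordered / inhomogeneous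
Bernoulli percolation.  The refuters' remarks on the crux are respected: the conclusion is in the
annealed `∫`-form and the a.e.-quenched form is the interface between the stubs (no junk-integral
trap: under `IsDiscreteGFF` every `g_x` is a.e.-measurable, `IsGaussianProcess.aemeasurable`); the
GFF covariance hypothesis is kept in every stub that needs Gaussian tails or decoupling.

Layout: §0 readable forms (`islandWeight`, the crux in `lupuWeight` form, name-keyed stub
statements `__Registered.stub_*`) · §1 the three registered stubs `theorem stub_* : <spelled-out, def-free
signature> := by sorry` (the only `sorry`s) · §2 the composition · §3 definitional consistency.
-/

noncomputable section

namespace Summit.CriticalPhenomena.PercolationContinuityZ3.Cruxes.SubcriticalDisorderStability.Birth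

open Literature.Probability.Percolation Literature.Probability.LatticeModels
open MeasureTheory ProbabilityTheory Filter Topology

/-! ## §0 Readable forms -/

open scoped Classical in
/-- The SEA–ISLAND weights: a bond of `ℤ³` touching the island set `S` is open with probability
`1`, any other bond of `ℤ³` with probability `q`, non-bonds never. -/
def islandWeight (S : Set (Site 3)) (q : unitInterval) : Sym2 (Site 3) → unitInterval :=
  fun e => if e ∈ (zdGraph 3).edgeSet then (if ∃ x, x ∈ e ∧ x ∈ S then 1 else q) else 0

/-- The crux with the route's inline `let W := …` replaced by the Literature name `lupuWeight`
(definitionally equal, `crux_iff_lupuForm`). -/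
def CruxLupuForm : Prop :=
  ∀ (Ω : Type) [MeasurableSpace Ω] (P : Measure Ω) [IsProbabilityMeasure P]
    (g : Site 3 → Ω → ℝ), IsGaussianProcess g P → (∀ x, ∫ ω, g x ω ∂P = 0) →
    (∀ x y, ∫ ω, g x ω * g y ω ∂P = latticeGreen (d := 3) (x - y) / 2) →
    ∀ a : ℝ, 0 < a → 1 - Real.exp (-2 * a ^ 2) < criticalProb (zdGraph 3) (0 : Site 3) →
    ∃ σ₁ : ℝ, 0 < σ₁ ∧ ∀ σ : ℝ, 0 < σ → σ < σ₁ →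
      ∫ ω, (prodBernoulli (lupuWeight fun x => a + σ * g x ω)).real
        (percolatesAt (0 : Site 3)) ∂P = 0

/-- The route decl IS `CruxLupuForm` (the `let` ζ-reduces to `lupuWeight (d := 3)`). -/
theorem crux_iff_lupuForm :
    Summit.CriticalPhenomena.PercolationContinuityZ3.Theses.PercLupuEnvironment.SubcriticalDisorderStability
      ↔ CruxLupuForm :=
  Iff.rfl

namespace __Registered

/-- Name-keyed statement of `stub_islandDomination` (the native skeleton audit admits a hypothesis
of the skeleton theorem only if its head constant is NAMED like a declared stub; the `__`
namespace is an implementation detail, device of `Cruxes/SubseqDescribable/Lines/birth.lean`). -/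
abbrev stub_islandDomination : Prop :=
  ∀ (φ : Site 3 → ℝ) (t : ℝ), 0 < t → ∀ S : Set (Site 3), {x | t < φ x} ⊆ S →
    ∀ q : unitInterval, 1 - Real.exp (-2 * t ^ 2) ≤ (q : ℝ) →
      (prodBernoulli (lupuWeight φ)).real (percolatesAt (0 : Site 3)) ≤
        (prodBernoulli (islandWeight S q)).real (percolatesAt (0 : Site 3))

/-- Name-keyed statement of `stub_seedEstimate`. -/
abbrev stub_seedEstimate : Prop :=
  ∀ (Ω : Type) [MeasurableSpace Ω] (P : Measure Ω) [IsProbabilityMeasure P]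
    (g : Site 3 → Ω → ℝ), IsDiscreteGFF P g →
    ∀ q : unitInterval, (q : ℝ) < criticalProb (zdGraph 3) (0 : Site 3) →
    ∀ κ : ℝ, 0 < κ → ∀ N₀ : ℕ, ∃ N : ℕ, N₀ ≤ N ∧ ∃ h₁ : ℝ, ∀ h : ℝ, h₁ ≤ h →
      ((box 3 N).card : ℝ) *
          ∫ ω, (prodBernoulli (islandWeight {x | h ≤ g x ω} q)).real (siteToBoundary 3 N) ∂P ≤ κ

/-- Name-keyed statement of `stub_finiteSizeCriterion`. -/
abbrev stub_finiteSizeCriterion : Prop :=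
  ∃ κ : ℝ, 0 < κ ∧ ∃ N₀ : ℕ, ∀ (Ω : Type) [MeasurableSpace Ω] (P : Measure Ω)
    [IsProbabilityMeasure P] (g : Site 3 → Ω → ℝ), IsDiscreteGFF P g →
    ∀ (q : unitInterval) (h : ℝ) (N : ℕ), N₀ ≤ N →
      ((box 3 N).card : ℝ) *
          ∫ ω, (prodBernoulli (islandWeight {x | h - 1 ≤ g x ω} q)).real
            (siteToBoundary 3 N) ∂P ≤ κ →
      ∀ᵐ ω ∂P, prodBernoulli (islandWeight {x | h ≤ g x ω} q) (percolatesAt (0 : Site 3)) = 0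

end __Registered

/-! ## §1 Registered stubs (the only `sorry`s of the file; signatures spelled out def-free over
tree declarations — `islandWeight` inlined — so that stub provers can restate them verbatim) -/

open scoped Classical in
/-- **Stub 1 — ISLAND DOMINATION (quenched transfer to the sea–island model).**  For every field
`φ : ℤ³ → ℝ`, threshold `t > 0`, island set `S ⊇ {t < φ}` and sea density `q ≥ 1 − e^{−2t²}`:
`P^{lupuWeight φ}(|C(0)| = ∞) ≤ 𝐏_{S,q}(|C(0)| = ∞)`.  Proof route: the weights compare pointwise
(`(φ_x)⁺(φ_y)⁺ ≤ t²` off `S`, weight `1` on the star of `S`, `0` off `E(ℤ³)` on both sides), then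
`prodBernoulli_real_mono_of_isUpperSet` with `isUpperSet_percolatesAt`,
`measurableSet_percolatesAt_holds`.  Size M. -/
theorem stub_islandDomination :
    ∀ (φ : Site 3 → ℝ) (t : ℝ), 0 < t → ∀ S : Set (Site 3), {x | t < φ x} ⊆ S →
      ∀ q : unitInterval, 1 - Real.exp (-2 * t ^ 2) ≤ (q : ℝ) →
        (prodBernoulli (lupuWeight φ)).real (percolatesAt (0 : Site 3)) ≤
          (prodBernoulli (fun e : Sym2 (Site 3) => if e ∈ (zdGraph 3).edgeSet then
              (if ∃ x, x ∈ e ∧ x ∈ S then (1 : unitInterval) else q) else 0)).real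
            (percolatesAt (0 : Site 3)) := by
  sorry

open scoped Classical in
/-- **Stub 2 — SEED ESTIMATE (one good scale for the sea–island model).**  For every discrete
GFF `g` of `ℤ³`, every sea density `q < p_c(ℤ³)`, every `κ > 0` and `N₀ ∈ ℕ` there are a scale
`N ≥ N₀` and a level `h₁` such that for all `h ≥ h₁`:
`|Λ_N| · ∫ 𝐏_{{g(ω)≥h},q}(0 ↔ ∂Λ_N in Λ_N) dP(ω) ≤ κ`.  Proof route: `perc_sharpness_holds`
(`d = 3`) gives `θ_N(q) ≤ e^{−cN}`, so `|Λ_N| θ_N(q) ≤ κ/2` for some `N ≥ N₀`; the one-arm event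
is determined by the bonds inside `Λ_N`, which carry weight `q` unless an endpoint lies in the
island set, so the quenched probability is `≤ θ_N(q) + 𝟙[∃ x ∈ Λ_N, g_x(ω) ≥ h]`; integrate and
use `P(g_x ≥ h) ≤ E[g_x²]/h² = latticeGreen(0)/(2h²)` (union over `|Λ_N|` sites).  Size M. -/
theorem stub_seedEstimate :
    ∀ (Ω : Type) [MeasurableSpace Ω] (P : Measure Ω) [IsProbabilityMeasure P]
      (g : Site 3 → Ω → ℝ), IsDiscreteGFF P g →
      ∀ q : unitInterval, (q : ℝ) < criticalProb (zdGraph 3) (0 : Site 3) →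
      ∀ κ : ℝ, 0 < κ → ∀ N₀ : ℕ, ∃ N : ℕ, N₀ ≤ N ∧ ∃ h₁ : ℝ, ∀ h : ℝ, h₁ ≤ h →
        ((box 3 N).card : ℝ) *
            ∫ ω, (prodBernoulli (fun e : Sym2 (Site 3) => if e ∈ (zdGraph 3).edgeSet then
                (if ∃ x, x ∈ e ∧ h ≤ g x ω then (1 : unitInterval) else q) else 0)).real
              (siteToBoundary 3 N) ∂P ≤ κ := by
  sorry

open scoped Classical in
/-- **Stub 3 — FINITE-SIZE CRITERION for the sea–island model (sprinkled multiscale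
renormalisation; the hardest stub).**  There are universal `κ > 0` and `N₀` such that for every
discrete GFF `g` of `ℤ³`, every `q ∈ [0,1]`, every level `h` and every scale `N ≥ N₀`: if
`|Λ_N| · ∫ 𝐏_{{g(ω)≥h−1},q}(0 ↔ ∂Λ_N in Λ_N) dP(ω) ≤ κ` then for `P`-a.e. `ω` the sea–island
model at level `h` has no infinite cluster at the origin.  Proof route: Rodriguez–Sznitman cascade
(doi:10.1007/s00220-012-1649-y §2–3) at scales `L_n = l₀ⁿ N` for the joint field `(η, g)`, `η`
the Bernoulli(`q`) sea independent of `g`: `p_{n+1}(h_{n+1}) ≤ C l₀⁴ (p_n(h_n)² + err_n)` with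
levels `h_n = h − 1 + Σ_{k<n} 2^{−(k+1)} ↑ h`, where the `η`-parts of the two far-apart
annulus-crossing events are exactly independent and the `g`-parts (increasing in `g`) obey the
sprinkled decoupling inequality of Popov–Ráth (doi:10.1007/s10955-015-1187-z Thm 1.1, error
`exp(−c δ² s)` in `d = 3`); seed `p₀ ≤ |Λ_N| π_{h−1}(N)` by the union bound and stationarity of
the joint law; `π_h(L_n) ≤ p_n → 0` gives annealed, hence a.e.-quenched (measurability under
`IsDiscreteGFF`), non-percolation.  Size L–XL (the decoupling inequality is not yet a Literature
fact). -/
theorem stub_finiteSizeCriterion :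
    ∃ κ : ℝ, 0 < κ ∧ ∃ N₀ : ℕ, ∀ (Ω : Type) [MeasurableSpace Ω] (P : Measure Ω)
      [IsProbabilityMeasure P] (g : Site 3 → Ω → ℝ), IsDiscreteGFF P g →
      ∀ (q : unitInterval) (h : ℝ) (N : ℕ), N₀ ≤ N →
        ((box 3 N).card : ℝ) *
            ∫ ω, (prodBernoulli (fun e : Sym2 (Site 3) => if e ∈ (zdGraph 3).edgeSet then
                (if ∃ x, x ∈ e ∧ h - 1 ≤ g x ω then (1 : unitInterval) else q) else 0)).real
              (siteToBoundary 3 N) ∂P ≤ κ →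
        ∀ᵐ ω ∂P, prodBernoulli (fun e : Sym2 (Site 3) => if e ∈ (zdGraph 3).edgeSet then
            (if ∃ x, x ∈ e ∧ h ≤ g x ω then (1 : unitInterval) else q) else 0)
          (percolatesAt (0 : Site 3)) = 0 := by
  sorry

/-! ## §2 Composition (kernel-checked, no `sorry`): the three stubs give the crux by name -/

/-- Margin: the set of subcritical levels is open. -/
theorem exists_margin {a c : ℝ} (h : 1 - Real.exp (-2 * a ^ 2) < c) :
    ∃ δ : ℝ, 0 < δ ∧ 1 - Real.exp (-2 * (a + δ) ^ 2) < c := by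
  have hcont : Continuous fun s : ℝ => 1 - Real.exp (-2 * s ^ 2) := by fun_prop
  have hev : ∀ᶠ s in 𝓝 a, 1 - Real.exp (-2 * s ^ 2) < c :=
    hcont.continuousAt.eventually_lt continuousAt_const h
  obtain ⟨ε, hε, hball⟩ := Metric.eventually_nhds_iff.1 hev
  refine ⟨ε / 2, by positivity, hball ?_⟩
  rw [Real.dist_eq, add_sub_cancel_left, abs_of_pos (by positivity)]
  linarith

theorem SubcriticalDisorderStability_of (h1 : __Registered.stub_islandDomination)
    (h2 : __Registered.stub_seedEstimate) (h3 : __Registered.stub_finiteSizeCriterion) :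
    Summit.CriticalPhenomena.PercolationContinuityZ3.Theses.PercLupuEnvironment.SubcriticalDisorderStability := by
  rw [crux_iff_lupuForm]
  intro Ω _ P _ g hGauss hmean hcov a ha hlt
  have hGFF : IsDiscreteGFF P g := ⟨hGauss, hmean, hcov⟩
  -- margin δ and the sea density q = 1 - e^{-2(a+δ)²} < p_c
  obtain ⟨δ, hδ, hqc⟩ := exists_margin hlt
  set t : ℝ := a + δ with ht_def
  have ht : 0 < t := by positivity
  have hqmem : 1 - Real.exp (-2 * t ^ 2) ∈ Set.Icc (0 : ℝ) 1 := by
    rw [sq]; exact one_sub_exp_mem_Icc ht.le ht.le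
  set q : unitInterval := ⟨1 - Real.exp (-2 * t ^ 2), hqmem⟩ with hq_def
  have hqval : (q : ℝ) = 1 - Real.exp (-2 * t ^ 2) := rfl
  have hqlt : (q : ℝ) < criticalProb (zdGraph 3) (0 : Site 3) := by rw [hqval]; exact hqc
  have hqge : 1 - Real.exp (-2 * t ^ 2) ≤ (q : ℝ) := hqval.ge
  -- universal threshold of the finite-size criterion, then one good scale from the seed estimate
  obtain ⟨κ, hκ, N₀, H3⟩ := h3
  obtain ⟨N, hN, h₁, H2⟩ := h2 Ω P g hGFF q hqlt κ hκ N₀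
  -- the level threshold h₀ ≥ 1 with h₀ - 1 ≥ h₁, and σ₁ := δ / h₀
  set h₀ : ℝ := max (h₁ + 1) 1 with hh₀_def
  have hh₀1 : 1 ≤ h₀ := le_max_right _ _
  have hh₀pos : 0 < h₀ := one_pos.trans_le hh₀1
  refine ⟨δ / h₀, div_pos hδ hh₀pos, fun σ hσ hσlt => ?_⟩
  -- the level lev = δ/σ > h₀
  set lev : ℝ := δ / σ with hlev_def
  have hlevel : h₀ < lev := by
    have h1' : δ / (δ / h₀) = h₀ := by field_simp
    have := div_lt_div_of_pos_left hδ hσ hσlt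
    rwa [h1'] at this
  have hlevel₁ : h₁ ≤ lev - 1 := by
    have : h₁ + 1 ≤ h₀ := le_max_left _ _
    linarith
  -- criterion at level lev - 1, conclusion at level lev
  have hcrit := H2 (lev - 1) hlevel₁
  have hae := H3 Ω P g hGFF q lev N hN hcrit
  -- domination, realisation by realisation
  have hzero : ∀ᵐ ω ∂P, (prodBernoulli (lupuWeight fun x => a + σ * g x ω)).real
      (percolatesAt (0 : Site 3)) = 0 := by
    filter_upwards [hae] with ω hω
    have hsub : {x : Site 3 | t < (fun x => a + σ * g x ω) x} ⊆ {x | lev ≤ g x ω} := by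
      intro x hx
      simp only [Set.mem_setOf_eq, ht_def] at hx
      have hx' : δ < g x ω * σ := by linarith [mul_comm σ (g x ω)]
      have hx'' : δ / σ < g x ω := by rwa [div_lt_iff₀ hσ]
      exact hx''.le
    have hle := h1 (fun x => a + σ * g x ω) t ht {x | lev ≤ g x ω} hsub q hqge
    have hz : (prodBernoulli (islandWeight {x | lev ≤ g x ω} q)).real
        (percolatesAt (0 : Site 3)) = 0 := by
      rw [measureReal_def]
      have : prodBernoulli (islandWeight {x | lev ≤ g x ω} q) (percolatesAt (0 : Site 3)) = 0 := hω
      rw [this, ENNReal.toReal_zero]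
    exact le_antisymm (hle.trans hz.le) measureReal_nonneg
  exact integral_eq_zero_of_ae hzero

/-! ## §3 Definitional consistency: the registered stubs feed the composition verbatim -/

/-- The registered stub 1, as spelled out, IS `__Registered.stub_islandDomination`. -/
theorem islandDomination_registered : __Registered.stub_islandDomination := stub_islandDomination

/-- The registered stub 2, as spelled out, IS `__Registered.stub_seedEstimate`. -/
theorem seedEstimate_registered : __Registered.stub_seedEstimate := stub_seedEstimate

/-- The registered stub 3, as spelled out, IS `__Registered.stub_finiteSizeCriterion`. -/
theorem finiteSizeCriterion_registered : __Registered.stub_finiteSizeCriterion := stub_finiteSizeCriterion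

/- The crux from the three registered stubs (an `example`, so no `sorry`-tainted proof of the crux
enters the environment under a name). -/
example :
    Summit.CriticalPhenomena.PercolationContinuityZ3.Theses.PercLupuEnvironment.SubcriticalDisorderStability :=
  SubcriticalDisorderStability_of stub_islandDomination stub_seedEstimate stub_finiteSizeCriterion

end Summit.CriticalPhenomena.PercolationContinuityZ3.Cruxes.SubcriticalDisorderStability.Birth

end
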